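import Literature.Probability.RandomPlanarGeometry.SLE
import Literature.Probability.RandomPlanarGeometry.LocalMartingaleProofs
import HarnessLib

/-!
# `stub_sleOsc` — oscillation quantile of the SLE(8/3) driving function
(crux `PathUpgradeR`, stmt-CriticalPhenomena-18055, route `SAWReversalUpgrade`,
line `bidir_windows`)

Landing target:
`Summits/CriticalPhenomena/SAWScalingLimit/Theorems/SAWReversalUpgradePathUpgradeRSLEOsc.lean`
(`--supports stmt-CriticalPhenomena-18055`; registered stub `stub_sleOsc`).

The registered theorem `stub_sleOsc` is a quantile lemma for the SLE(8/3) reference driving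
function `V = sleDriving (8/3) ω` (`= √(8/3) · B(ω)` under `P' = preWienerMeasure`): for every
horizon `T`, level `ρ > 0` and budget `β > 0` there is a deterministic mesh `τ > 0` such that the
event "`ρ < |V s - V s'|` for some `s, s' ≤ T + 1` with `|s - s'| ≤ τ`" has `P'`-measure `≤ β`.

Proof (sub-namespace `PathUpgradeRSLERegOsc`, general `κ`): every path `V` is continuous
(`continuous_sleDriving`), hence uniformly continuous on the compact `[0, T + 2]`
(`exists_nat_forall_dist_lt`), so the measurable supersets
`B n := {∃ q q' ∈ S, q, q' < T + 2, dist q q' < 2/(n+1), ρ < dist (V q) (V q')}` (`S` a countable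
dense set of times; marginal measurability `measurable_sleDriving`) decrease to the EMPTY set;
continuity of the probability measure `P'` from above (`tendsto_measure_iInter_atTop`) gives
`P' (B n) → 0`, and the event of the statement with `τ := 1/(n+1)` is contained in `B n` by
continuity of `V` and density of `S ×ˢ S` (`exists_mem_dense_pair`). This imitates
`PathUpgradeRRangeBound.exists_measure_tail_le`.
-/

noncomputable section

open scoped ENNReal NNReal Topology
open MeasureTheory Filter Set Metric TopologicalSpace
open Literature.Probability Literature.Probability.RandomPlanarGeometry

namespace Summit.CriticalPhenomena.SAWScalingLimit.Theorems

namespace PathUpgradeRSLERegOsc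

/-! ### Deterministic core -/

/-- Uniform continuity of a continuous path on the compact `[0, T + 2]`, in mesh form: for every
`ρ > 0` some `n` has `dist (V q) (V q') < ρ` whenever `q, q' < T + 2` and `dist q q' < 2/(n+1)`
(Heine–Cantor, `IsCompact.uniformContinuousOn_of_continuous`). [folklore] -/
theorem exists_nat_forall_dist_lt {V : ℝ≥0 → ℝ} (hV : Continuous V) (T : ℝ≥0) {ρ : ℝ}
    (hρ : 0 < ρ) :
    ∃ n : ℕ, ∀ q q' : ℝ≥0, q < T + 2 → q' < T + 2 → dist q q' < 2 / ((n : ℝ) + 1) →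
      dist (V q) (V q') < ρ := by
  obtain ⟨δ, hδ, hV'⟩ := Metric.uniformContinuousOn_iff.1
    ((isCompact_Icc : IsCompact (Icc (0 : ℝ≥0) (T + 2))).uniformContinuousOn_of_continuous
      hV.continuousOn) ρ hρ
  obtain ⟨n, hn⟩ := exists_nat_one_div_lt (half_pos hδ)
  refine ⟨n, fun q q' hq hq' hqq' ↦ hV' q ⟨zero_le, hq.le⟩ q' ⟨zero_le, hq'.le⟩ ?_⟩
  calc dist q q' < 2 / ((n : ℝ) + 1) := hqq'
    _ = 2 * (1 / ((n : ℝ) + 1)) := by ring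
    _ < 2 * (δ / 2) := by gcongr
    _ = δ := by ring

/-- Approximation of a bad pair of times by times of a dense set: the four conditions
`s < T + 2`, `s' < T + 2`, `dist s s' < c`, `ρ < dist (V s) (V s')` are jointly open in `(s, s')`
for a continuous `V`, and `S ×ˢ S` is dense for a dense `S`. [folklore] -/
theorem exists_mem_dense_pair {V : ℝ≥0 → ℝ} (hV : Continuous V) {S : Set ℝ≥0} (hS : Dense S)
    {T : ℝ≥0} {c ρ : ℝ} {s s' : ℝ≥0} (hs : s < T + 2) (hs' : s' < T + 2) (hss' : dist s s' < c)
    (hρ : ρ < dist (V s) (V s')) :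
    ∃ q ∈ S, ∃ q' ∈ S, q < T + 2 ∧ q' < T + 2 ∧ dist q q' < c ∧ ρ < dist (V q) (V q') := by
  have hopen : IsOpen {p : ℝ≥0 × ℝ≥0 | p.1 < T + 2 ∧ p.2 < T + 2 ∧ dist p.1 p.2 < c ∧
      ρ < dist (V p.1) (V p.2)} :=
    (isOpen_lt continuous_fst continuous_const).inter
      ((isOpen_lt continuous_snd continuous_const).inter
        ((isOpen_lt (continuous_fst.dist continuous_snd) continuous_const).inter
          (isOpen_lt continuous_const
            ((hV.comp continuous_fst).dist (hV.comp continuous_snd)))))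
  obtain ⟨⟨q, q'⟩, ⟨hqS, hq'S⟩, hq, hq', hqq', hρq⟩ :=
    (hS.prod hS).exists_mem_open hopen ⟨(s, s'), hs, hs', hss', hρ⟩
  exact ⟨q, hqS, q', hq'S, hq, hq', hqq', hρq⟩

/-! ### The quantile lemma for a general `κ` -/

/-- **Oscillation quantile, general form.** For the SLE_κ driving function `V = sleDriving κ ω`,
every horizon `T`, level `ρ > 0` and `β ≠ 0`, some `n` has
`P' {∃ s s' ≤ T + 1, |s - s'| ≤ 1/(n+1), ρ < |V s - V s'|} ≤ β`: continuity from above along the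
measurable supersets `B n` (countable dense set of times), whose intersection is empty because
every path is uniformly continuous on `[0, T + 2]` (`exists_nat_forall_dist_lt`). [folklore] -/
theorem exists_measure_osc_le (κ T : ℝ≥0) {ρ : ℝ} (hρ : 0 < ρ) {β : ℝ≥0∞} (hβ : β ≠ 0) :
    ∃ n : ℕ, Process.preWienerMeasure {ω | ∃ s s' : ℝ≥0, (s : ℝ) ≤ T + 1 ∧ (s' : ℝ) ≤ T + 1 ∧
      |(s : ℝ) - s'| ≤ 1 / ((n : ℝ) + 1) ∧ ρ < |sleDriving κ ω s - sleDriving κ ω s'|} ≤ β := by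
  haveI : IsProbabilityMeasure Process.preWienerMeasure := isProbabilityMeasure_preWienerMeasure'
  obtain ⟨S, hSc, hSd⟩ := TopologicalSpace.exists_countable_dense ℝ≥0
  obtain ⟨B, hBmem⟩ : ∃ B : ℕ → Set (ℝ≥0 → ℝ), ∀ n ω, ω ∈ B n ↔ ∃ q ∈ S, ∃ q' ∈ S,
      q < T + 2 ∧ q' < T + 2 ∧ dist q q' < 2 / ((n : ℝ) + 1) ∧
        ρ < dist (sleDriving κ ω q) (sleDriving κ ω q') :=
    ⟨fun n ↦ {ω | ∃ q ∈ S, ∃ q' ∈ S, q < T + 2 ∧ q' < T + 2 ∧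
      dist q q' < 2 / ((n : ℝ) + 1) ∧ ρ < dist (sleDriving κ ω q) (sleDriving κ ω q')},
      fun _ _ ↦ Iff.rfl⟩
  have hBm : ∀ n, MeasurableSet (B n) := by
    intro n
    have hrep : B n = ⋃ q ∈ S, ⋃ q' ∈ S, {ω | q < T + 2 ∧ q' < T + 2 ∧
        dist q q' < 2 / ((n : ℝ) + 1) ∧ ρ < dist (sleDriving κ ω q) (sleDriving κ ω q')} := by
      ext ω
      simp only [hBmem, mem_iUnion, mem_setOf_eq, exists_prop]
    rw [hrep]
    refine MeasurableSet.biUnion hSc fun q _ ↦ MeasurableSet.biUnion hSc fun q' _ ↦ ?_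
    exact (MeasurableSet.const _).inter ((MeasurableSet.const _).inter
      ((MeasurableSet.const _).inter (measurableSet_lt measurable_const
        ((measurable_sleDriving κ q).dist (measurable_sleDriving κ q')))))
  have hanti : Antitone B := fun n n' hnn' ω hω ↦ by
    obtain ⟨q, hqS, q', hq'S, hq, hq', hqq', hρq⟩ := (hBmem n' ω).1 hω
    refine (hBmem n ω).2 ⟨q, hqS, q', hq'S, hq, hq', hqq'.trans_le ?_, hρq⟩
    gcongr
  have hnull : Process.preWienerMeasure (⋂ n, B n) = 0 := by
    have hempty : (⋂ n, B n) = ∅ := by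
      refine eq_empty_of_forall_notMem fun ω hmem ↦ ?_
      obtain ⟨n, hn⟩ := exists_nat_forall_dist_lt (continuous_sleDriving κ ω) T hρ
      obtain ⟨q, -, q', -, hq, hq', hqq', hρq⟩ := (hBmem n ω).1 (mem_iInter.1 hmem n)
      exact absurd (hn q q' hq hq' hqq') (not_lt.2 hρq.le)
    rw [hempty, measure_empty]
  have htend := tendsto_measure_iInter_atTop (μ := Process.preWienerMeasure)
    (fun n ↦ (hBm n).nullMeasurableSet) hanti ⟨0, measure_ne_top _ _⟩
  rw [hnull] at htend
  obtain ⟨n, hn⟩ := (htend.eventually_lt_const (pos_iff_ne_zero.2 hβ)).exists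
  refine ⟨n, (measure_mono ?_).trans hn.le⟩
  rintro ω ⟨s, s', hs, hs', hss', hρs⟩
  have h2 : ∀ u : ℝ≥0, (u : ℝ) ≤ T + 1 → u < T + 2 := fun u hu ↦ by
    rw [← NNReal.coe_lt_coe]
    push_cast
    linarith
  have hss'2 : dist s s' < 2 / ((n : ℝ) + 1) := by
    rw [NNReal.dist_eq]
    calc |(s : ℝ) - s'| ≤ 1 / ((n : ℝ) + 1) := hss'
      _ < 2 / ((n : ℝ) + 1) := by gcongr; norm_num
  have hρs' : ρ < dist (sleDriving κ ω s) (sleDriving κ ω s') := by rwa [Real.dist_eq]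
  exact (hBmem n ω).2
    (exists_mem_dense_pair (continuous_sleDriving κ ω) hSd (h2 s hs) (h2 s' hs') hss'2 hρs')

end PathUpgradeRSLERegOsc

/-- **SLE oscillation quantile** (registered stub `stub_sleOsc` of crux `PathUpgradeR`, line
`bidir_windows`): for the SLE(8/3) reference driving function `V = sleDriving (8/3) ω`, every
horizon `T`, level `ρ > 0` and budget `β > 0` admit a deterministic mesh `τ > 0` with
`P' {∃ s s' ≤ T + 1, |s - s'| ≤ τ, ρ < |V s - V s'|} ≤ β` (uniform continuity of every path on
`[0, T + 2]` and continuity of the probability measure `P'` from above,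
`PathUpgradeRSLERegOsc.exists_measure_osc_le`). [folklore] -/
theorem stub_sleOsc : ∀ (T : NNReal) (ρ : ℝ), 0 < ρ → ∀ β : ENNReal, 0 < β → ∃ τ : ℝ, 0 < τ ∧ Literature.Probability.Process.preWienerMeasure {ω | ∃ s s' : NNReal, (s : ℝ) ≤ T + 1 ∧ (s' : ℝ) ≤ T + 1 ∧ |(s : ℝ) - s'| ≤ τ ∧ ρ < |Literature.Probability.RandomPlanarGeometry.sleDriving ((8:NNReal)/3) ω s - Literature.Probability.RandomPlanarGeometry.sleDriving ((8:NNReal)/3) ω s'|} ≤ β := by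
  intro T ρ hρ β hβ
  obtain ⟨n, hn⟩ := PathUpgradeRSLERegOsc.exists_measure_osc_le ((8 : ℝ≥0) / 3) T hρ hβ.ne'
  exact ⟨1 / ((n : ℝ) + 1), by positivity, hn⟩

end Summit.CriticalPhenomena.SAWScalingLimit.Theorems

end
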